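import Summits.Ventures.PercRepro.RankLevelSetLevelSixHeavyCellSq27DI
import Summits.Ventures.PercRepro.RankLevelSetLevelSixCapGlue25
import Summits.Ventures.PercRepro.TriangleCapEightI
import Summits.Ventures.PercRepro.S1TrianglePlusSharp
import Summits.Ventures.PercRepro.S1SeriesLever14
import Summits.Ventures.PercRepro.RankLevelSetLevelSixArithHeavySq24DIA
import Summits.Ventures.PercRepro.RankLevelSetLevelSixArithHeavySq24DIB
import Summits.Ventures.PercRepro.RankLevelSetLevelSixArithHeavySq24DIC
import Summits.Ventures.PercRepro.RankLevelSetLevelSixArithHeavySq24DID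

/-!
# PercRepro — THE 25 ROW, THE COLOOP CASE, LEVEL ONE: THE SCALED COLOOP-FREE CELLS `(p ≥ 24, 7 ≤ d ≤ 14)` (p8 g9, S3)

`proofs/SUBCLAIM-S3-p8.md` §3w (THE 25 ROW). Axioms: standard.
-/

open scoped Matroid

namespace PercRepro

namespace ThmN

open Set

variable {α : Type}

/-- **The SCALED cell on every COLOOP-FREE `e`-free core of rank `p ≥ 24`, corank `7 ≤ d ≤ 14`**: `(Φ(p+1, 6)/2)·#U(p, 6) ≤ #Y(p, 6)` (the corrected cell with `D = C(p + 7, 6)`, `Φ(p+1, 6)/2 ≤ 2^{p+6}/D` (`phiK_succ_div_two_le`), the per-corank parameters of ArithHeavySq24DIA … D and the coloop-free caps with `m = 24 + d`) — level one of the coloop split of the `25` row (`M ∖ e` coloop-free). -/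
theorem c025_core_six_scaled_heavy_sq24s (M : Matroid α) [M.Finite] (p d : ℕ) (hp : 24 ≤ p) (hd7 : 7 ≤ d) (hd14 : d ≤ 14) (hcf : ∀ e ∈ M.E, ¬ M.IsColoop e)
    (hR : M.eRank = (p : ℕ∞)) (hn : M.E.ncard = p + d)
    (hfree : ∀ e ∈ M.E, ∃ A ⊆ M.E \ {e}, e ∉ M.closure A ∧ e ∉ M.closure ((M.E \ {e}) \ A)) :
    phiK (p + 1) 6 / 2 * (Matroid.topCount M p 6 : ℚ) ≤ (Matroid.midCount M p 6 : ℚ) := by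
  have hd : M.E.encard = M.eRank + d := by
    rw [hR, ← M.ground_finite.cast_ncard_eq, hn]
    push_cast
    ring
  have hL : ∀ e ∈ M.E, ¬ M.IsLoop e := not_isLoop_of_free M hfree
  have hs : ∀ e ∈ M.E, ∀ f ∈ M.E, e ≠ f → M.eRk {e, f} = 2 := by
    intro e he f hf hef
    have h2 : (2 : ℕ∞) ≤ M.eRk {e, f} :=
      two_le_eRk_of_two_le_ncard_of_free M hfree (pair_subset he hf) (by rw [ncard_pair hef])
    have h3 : M.eRk {e, f} ≤ 2 := by
      have := M.eRk_le_encard {e, f}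
      rwa [encard_pair hef] at this
    exact le_antisymm h3 h2
  have hC1 : ∀ L ⊆ M.E, M.eRk L = 2 → L.ncard ≤ 3 :=
    fun L hL hr => ncard_le_three_of_eRk_two M hs hfree hL hr
  have hC2 : ∀ P ⊆ M.E, M.eRk P ≤ 3 → P.ncard ≤ 6 :=
    fun P hP hr => ncard_le_six_of_eRk_le_three_of_free M hfree hP hr
  have hΦ : phiK (p + 1) 6 / 2 ≤ (2 : ℚ) ^ (p + 6) / (((p + 7).choose 6 : ℕ) : ℚ) := by
    have := phiK_succ_div_two_le p 6
    rwa [show p + 1 + 6 = p + 7 by omega] at this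
  interval_cases d
  · exact c025_core_six_heavy_cell_sq27di M p 7 7 1 1 13 12 0 174255 1000 13 250 47 11
      ((p + 7).choose 6) (Nat.choose_pos (by omega)) (phiK (p + 1) 6 / 2) hΦ (by norm_num) (by omega)
      (by norm_num) (by norm_num) (by norm_num) (by norm_num) (by norm_num)
      (by norm_num [cnull]) (by norm_num [cnull]) (Or.inl (by norm_num)) (Or.inl (by norm_num)) (Or.inl (by norm_num)) (by norm_num) (by norm_num) (by norm_num)
      (s3_cf_of M hfree hcf (d := 6) (by simpa using hd) 31 11 (by norm_num) (by omega) (by norm_num [TriangleCap.cq3]) (by norm_num [TriangleCap.cq3]) (by norm_num [TriangleCap.cq3]))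
      (s4_cf_of M hfree hcf (d := 6) (by rw [hd]; norm_num) 31 41 47 (by norm_num) (by omega) (by decide) (by omega))
      (s5_cf_of M hfree hcf (d := 6) (by rw [hd]; norm_num) 31 210 250 (by norm_num) (by omega) (by decide) (by omega))
      (Or.inl (tail_six_heavy_sq24DI_7 p hp)) hR hn hfree (level_six_poly_heavy_sq24DI_7 p hp)
  · exact c025_core_six_heavy_cell_sq27di M p 8 7 2 1 16 14 0 145447 1000 14 426 69 12
      ((p + 7).choose 6) (Nat.choose_pos (by omega)) (phiK (p + 1) 6 / 2) hΦ (by norm_num) (by omega)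
      (by norm_num) (by norm_num) (by norm_num) (by norm_num) (by norm_num)
      (by norm_num [cnull]) (by norm_num [cnull]) (Or.inl (by norm_num)) (Or.inl (by norm_num)) (Or.inl (by norm_num)) (by norm_num) (by norm_num) (by norm_num)
      (s3_cf_of M hfree hcf (d := 7) (by simpa using hd) 32 12 (by norm_num) (by omega) (by norm_num [TriangleCap.cq3]) (by norm_num [TriangleCap.cq3]) (by norm_num [TriangleCap.cq3]))
      (s4_cf_of M hfree hcf (d := 7) (by rw [hd]; norm_num) 32 61 69 (by norm_num) (by omega) (by decide) (by omega))
      (s5_cf_of M hfree hcf (d := 7) (by rw [hd]; norm_num) 32 360 426 (by norm_num) (by omega) (by decide) (by omega))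
      (Or.inl (tail_six_heavy_sq24DI_8 p hp)) hR hn hfree (level_six_poly_heavy_sq24DI_8 p hp)
  · exact c025_core_six_heavy_cell_sq27di M p 9 7 2 1 19 16 0 103997 1000 15 689 100 14
      ((p + 7).choose 6) (Nat.choose_pos (by omega)) (phiK (p + 1) 6 / 2) hΦ (by norm_num) (by omega)
      (by norm_num) (by norm_num) (by norm_num) (by norm_num) (by norm_num)
      (by norm_num [cnull]) (by norm_num [cnull]) (Or.inl (by norm_num)) (Or.inl (by norm_num)) (Or.inl (by norm_num)) (by norm_num) (by norm_num) (by norm_num)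
      (s3_cf_of M hfree hcf (d := 8) (by simpa using hd) 33 14 (by norm_num) (by omega) (by norm_num [TriangleCap.cq3]) (by norm_num [TriangleCap.cq3]) (by norm_num [TriangleCap.cq3]))
      (s4_cf_of M hfree hcf (d := 8) (by rw [hd]; norm_num) 33 88 100 (by norm_num) (by omega) (by decide) (by omega))
      (s5_cf_of M hfree hcf (d := 8) (by rw [hd]; norm_num) 33 585 689 (by norm_num) (by omega) (by decide) (by omega))
      (Or.inl (tail_six_heavy_sq24DI_9 p hp)) hR hn hfree (level_six_poly_heavy_sq24DI_9 p hp)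
  · exact c025_core_six_heavy_cell_sq27di M p 10 8 2 1 20 17 0 69033 1000 16 1066 139 17
      ((p + 7).choose 6) (Nat.choose_pos (by omega)) (phiK (p + 1) 6 / 2) hΦ (by norm_num) (by omega)
      (by norm_num) (by norm_num) (by norm_num) (by norm_num) (by norm_num)
      (by norm_num [cnull]) (by norm_num [cnull]) (Or.inl (by norm_num)) (Or.inl (by norm_num)) (Or.inl (by norm_num)) (by norm_num) (by norm_num) (by norm_num)
      (s3_cf_of M hfree hcf (d := 9) (by simpa using hd) 34 17 (by norm_num) (by omega) (by norm_num [TriangleCap.cq3]) (by norm_num [TriangleCap.cq3]) (by norm_num [TriangleCap.cq3]))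
      (s4_cf_of M hfree hcf (d := 9) (by rw [hd]; norm_num) 34 123 139 (by norm_num) (by omega) (by decide) (by omega))
      (s5_cf_of M hfree hcf (d := 9) (by rw [hd]; norm_num) 34 910 1066 (by norm_num) (by omega) (by decide) (by omega))
      (Or.inl (tail_six_heavy_sq24DI_10 p hp)) hR hn hfree (level_six_poly_heavy_sq24DI_10 p hp)
  · exact c025_core_six_heavy_cell_sq27di M p 11 9 1 1 19 16 0 45157 1000 17 1592 188 21
      ((p + 7).choose 6) (Nat.choose_pos (by omega)) (phiK (p + 1) 6 / 2) hΦ (by norm_num) (by omega)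
      (by norm_num) (by norm_num) (by norm_num) (by norm_num) (by norm_num)
      (by norm_num [cnull]) (by norm_num [cnull]) (Or.inl (by norm_num)) (Or.inr (Or.inl ⟨by norm_num, by norm_num⟩)) (Or.inl (by norm_num)) (by norm_num) (by norm_num) (by norm_num)
      (s3_cf_of M hfree hcf (d := 10) (by simpa using hd) 35 21 (by norm_num) (by omega) (by norm_num [TriangleCap.cq3]) (by norm_num [TriangleCap.cq3]) (by norm_num [TriangleCap.cq3]))
      (s4_cf_of M hfree hcf (d := 10) (by rw [hd]; norm_num) 35 167 188 (by norm_num) (by omega) (by decide) (by omega))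
      (s5_cf_of M hfree hcf (d := 10) (by rw [hd]; norm_num) 35 1365 1592 (by norm_num) (by omega) (by decide) (by omega))
      (Or.inl (tail_six_heavy_sq24DI_11 p hp)) hR hn hfree (level_six_poly_heavy_sq24DI_11 p hp)
  · exact c025_core_six_heavy_cell_sq27di M p 12 10 1 1 20 17 0 29438 1000 18 2305 249 26
      ((p + 7).choose 6) (Nat.choose_pos (by omega)) (phiK (p + 1) 6 / 2) hΦ (by norm_num) (by omega)
      (by norm_num) (by norm_num) (by norm_num) (by norm_num) (by norm_num)
      (by norm_num [cnull]) (by norm_num [cnull]) (Or.inl (by norm_num)) (Or.inr (Or.inl ⟨by norm_num, by norm_num⟩)) (Or.inl (by norm_num)) (by norm_num) (by norm_num) (by norm_num)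
      (s3_cf_of M hfree hcf (d := 11) (by simpa using hd) 36 26 (by norm_num) (by omega) (by norm_num [TriangleCap.cq3]) (by norm_num [TriangleCap.cq3]) (by norm_num [TriangleCap.cq3]))
      (s4_cf_of M hfree hcf (d := 11) (by rw [hd]; norm_num) 36 222 249 (by norm_num) (by omega) (by decide) (by omega))
      (s5_cf_of M hfree hcf (d := 11) (by rw [hd]; norm_num) 36 1985 2305 (by norm_num) (by omega) (by decide) (by omega))
      (Or.inl (tail_six_heavy_sq24DI_12 p hp)) hR hn hfree (level_six_poly_heavy_sq24DI_12 p hp)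
  · exact c025_core_six_heavy_cell_sq27di M p 13 10 1 1 22 18 0 19832 1000 19 3251 325 31
      ((p + 7).choose 6) (Nat.choose_pos (by omega)) (phiK (p + 1) 6 / 2) hΦ (by norm_num) (by omega)
      (by norm_num) (by norm_num) (by norm_num) (by norm_num) (by norm_num)
      (by norm_num [cnull]) (by norm_num [cnull]) (Or.inl (by norm_num)) (Or.inr (Or.inl ⟨by norm_num, by norm_num⟩)) (Or.inl (by norm_num)) (by norm_num) (by norm_num) (by norm_num)
      (s3_cf_of M hfree hcf (d := 12) (by simpa using hd) 37 31 (by norm_num) (by omega) (by norm_num [TriangleCap.cq3]) (by norm_num [TriangleCap.cq3]) (by norm_num [TriangleCap.cq3]))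
      (s4_cf_of M hfree hcf (d := 12) (by rw [hd]; norm_num) 37 290 325 (by norm_num) (by omega) (by decide) (by omega))
      (s5_cf_of M hfree hcf (d := 12) (by rw [hd]; norm_num) 37 2812 3251 (by norm_num) (by omega) (by decide) (by omega))
      (Or.inl (tail_six_heavy_sq24DI_13 p hp)) hR hn hfree (level_six_poly_heavy_sq24DI_13 p hp)
  · exact c025_core_six_heavy_cell_sq27di M p 14 11 1 1 23 19 0 13800 1000 20 4482 415 36
      ((p + 7).choose 6) (Nat.choose_pos (by omega)) (phiK (p + 1) 6 / 2) hΦ (by norm_num) (by omega)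
      (by norm_num) (by norm_num) (by norm_num) (by norm_num) (by norm_num)
      (by norm_num [cnull]) (by norm_num [cnull]) (Or.inl (by norm_num)) (Or.inr (Or.inl ⟨by norm_num, by norm_num⟩)) (Or.inl (by norm_num)) (by norm_num) (by norm_num) (by norm_num)
      (s3_cf_of M hfree hcf (d := 13) (by simpa using hd) 38 36 (by norm_num) (by omega) (by norm_num [TriangleCap.cq3]) (by norm_num [TriangleCap.cq3]) (by norm_num [TriangleCap.cq3]))
      (s4_cf_of M hfree hcf (d := 13) (by rw [hd]; norm_num) 38 372 415 (by norm_num) (by omega) (by decide) (by omega))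
      (s5_cf_of M hfree hcf (d := 13) (by rw [hd]; norm_num) 38 3893 4482 (by norm_num) (by omega) (by decide) (by omega))
      (Or.inl (tail_six_heavy_sq24DI_14 p hp)) hR hn hfree (level_six_poly_heavy_sq24DI_14 p hp)
end ThmN

end PercRepro
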